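import Summits.Schanuel.Schanuel.Theorems.ZilberEacHyperplaneMixedDensity
import HarnessLib

/-!
# Mixed regime over real hyperplanes, every exponent: diagonal 3-folds and a rational-`ν` member of
# `EC(3,2)` with dense exponential points

Zilber's Exponential-Algebraic Closedness, case ladder (host summit Schanuel, cell `pub-schanuel`,
seat 2, gen 12).  Corollaries of `unprojectedDense_polyFibredGraph_hyperplane_mixed_all`
(`ZilberEacHyperplaneMixedDensity`):

* `unprojectedDense_mixed_diag_all` — the diagonal 3-folds
  `{x₂ = r₀x₀ + r₁x₁ + c, y₀ = x₀ + y₂F₀(y₂), y₁ = x₁ + y₂F₁(y₂)}` with `r₀ ≠ 0 ≠ r₁`, `F₀ ≠ 0`,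
  `F₁ = 0 ∨ deg F₁ < deg F₀`, `ν = (1/(1 + deg F₀) - r₁)/r₀ < 1` and `r₀ ∉ ℚ ∨ r₁ ∉ ℚ` are dense
  (gen 9's `unprojectedDense_mixed_diag` needed `ν ∉ ℚ`);
* **`sqrtTwoHalfMixed_member_dense`** — `W = {x₂ = √2x₀ + x₁/2, y₀ = x₀ + y₂², y₁ = x₁ + y₂}`
  (`e^z = z + e^{2(√2z + w/2)}`, `e^w = w + e^{√2z + w/2}`): `ν = (1/2 - 1/2)/√2 = 0 ∈ ℚ` — outside
  gen 9 — a certified member of `EC(3,2)`, not linearly split, meets `Γ_exp`, ZARISKI DENSE.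

HONEST FRAMING: explicit families inside an OPEN cell; `EC(3,2)` OPEN; NOT Schanuel's conjecture;
EAC ⇏ SC.
-/

noncomputable section

open Complex MvPolynomial Filter Topology
open Literature.NumberTheory.Transcendental Literature.ModelTheory.Zilber
  Literature.ModelTheory.ExponentialFields

set_option linter.dupNamespace false

namespace Summit.Schanuel.Schanuel.Theorems

section Diag

/-- **Diagonal 3-folds, mixed regime, EVERY `ν`: dense.**  `r₀ ≠ 0 ≠ r₁`, one of them irrational,
`F₀ ≠ 0`, `F₁ = 0 ∨ deg F₁ < deg F₀`, `ν = (1/(1 + deg F₀) - r₁)/r₀ < 1`. (new)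
[cite: MantovaMasser2023, §1 p.5 (the open case dim π(V) = 2 in ℂ³×ℂˣ³)] -/
theorem unprojectedDense_mixed_diag_all {r₀ r₁ : ℝ} (hr₀ : r₀ ≠ 0) (hr₁ : r₁ ≠ 0)
    (hirr : Irrational r₀ ∨ Irrational r₁) (c : ℂ)
    {F₀ : Polynomial ℂ} (hF₀ : F₀ ≠ 0) (F₁ : Polynomial ℂ) (hdeg : F₁ = 0 ∨ F₁.natDegree < F₀.natDegree)
    (hν : ((1 : ℝ) / (F₀.natDegree + 1) - r₁) / r₀ < 1) :
    UnprojectedDense (polyFibredGraph (hyperplanePoly ![r₀, r₁] c) (fun j => X j)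
      (fun j => ((![F₀, F₁] : Fin 2 → Polynomial ℂ) j).toMvPolynomial 0)) := by
  classical
  set r : Fin 2 → ℝ := ![r₀, r₁] with hr
  set A : Fin 2 → MvPolynomial (Fin 2) ℂ := fun j => X j with hAdef
  set F : Fin 2 → Polynomial ℂ := ![F₀, F₁] with hFdef
  have hr0 : r 0 = r₀ := rfl
  have hr1 : r 1 = r₁ := rfl
  have hF0 : F 0 = F₀ := rfl
  have hF1 : F 1 = F₁ := rfl
  set e : ℕ := F₀.natDegree + 1 with he
  set c₀ : ℂ := F₀.leadingCoeff with hc₀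
  have hc0 : c₀ ≠ 0 := Polynomial.leadingCoeff_ne_zero.2 hF₀
  have hr0' : (r₀ : ℂ) ≠ 0 := by exact_mod_cast hr₀
  -- the transformed polynomials (as in `unprojectedDense_mixed_diag`)
  set l : Fin 2 → ℂ := ![-c₀⁻¹ * ((r₀ : ℂ)⁻¹ * (e : ℂ)⁻¹), c₀⁻¹ * ((r₀ : ℂ)⁻¹ * (r₁ : ℂ))] with hl
  have hA0 : fastData r c A F 0 = ∑ i, C (l i) * X i + C (c₀⁻¹ * ((r₀ : ℂ)⁻¹ * c)) := by
    rw [fastData_zero, hAdef]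
    simp only [aeval_X, fastSubst, Fin.cons_zero, hF0, Fin.sum_univ_one]
    rw [show (Fin.succ (0 : Fin 1) : Fin 2) = 1 from rfl, hr0, hr1]
    simp only [Fin.sum_univ_two, hl, Matrix.cons_val_zero, Matrix.cons_val_one, map_neg, map_mul, ← hc₀,
      ← he]
    ring
  have hA1 : fastData r c A F 1 = X 1 := by
    rw [show (1 : Fin 2) = Fin.succ (0 : Fin 1) from rfl, fastData_succ, hAdef]
    simp only [aeval_X, fastSubst, Fin.cons_succ]
  have hl1 : l 1 ≠ 0 := by
    simp only [hl, Matrix.cons_val_one, Matrix.cons_val_fin_one]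
    have : (r₁ : ℂ) ≠ 0 := by exact_mod_cast hr₁
    exact mul_ne_zero (inv_ne_zero hc0) (mul_ne_zero (inv_ne_zero hr0') this)
  have hdeg0 : (fastData r c A F 0).totalDegree = 1 := by
    rw [hA0]; exact totalDegree_linearForm l _ hl1
  have hdeg1 : (fastData r c A F 1).totalDegree = 1 := by rw [hA1, totalDegree_X]
  have hAh : ∀ j, fastData r c A F j ≠ 0 := by
    refine Fin.forall_fin_two.2 ⟨?_, ?_⟩
    · intro h
      have := hdeg0
      rw [h, totalDegree_zero] at this
      exact zero_ne_one this
    · rw [hA1]; exact X_ne_zero 1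
  have hd0 : 0 < (fastData r c A F 0).totalDegree := by rw [hdeg0]; exact one_pos
  have hνeq : (((fastData r c A F 0).totalDegree : ℝ) / ((F 0).natDegree + 1) -
      ∑ i : Fin 1, r i.succ * (fastData r c A F i.succ).totalDegree) / r 0 =
      ((1 : ℝ) / (F₀.natDegree + 1) - r₁) / r₀ := by
    rw [Fin.sum_univ_one, show (Fin.succ (0 : Fin 1) : Fin 2) = 1 from rfl, hdeg0, hdeg1, hF0, hr0, hr1]
    simp
  have hν' : (((fastData r c A F 0).totalDegree : ℝ) / ((F 0).natDegree + 1) -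
      ∑ i : Fin 1, r i.succ * (fastData r c A F i.succ).totalDegree) / r 0 <
      (fastData r c A F 0).totalDegree := by
    rw [hνeq, hdeg0]; simpa using hν
  have hfast : ∀ i : Fin 1, F i.succ ≠ 0 →
      ((fastData r c A F 0).totalDegree : ℝ) * ((F i.succ).natDegree + 1) <
        ((F 0).natDegree + 1) * (fastData r c A F i.succ).totalDegree := by
    intro i hFi
    rw [Fin.fin_one_eq_zero i, show (Fin.succ (0 : Fin 1) : Fin 2) = 1 from rfl, hdeg0, hdeg1, hF0, hF1]
    rw [Fin.fin_one_eq_zero i, show (Fin.succ (0 : Fin 1) : Fin 2) = 1 from rfl, hF1] at hFi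
    rcases hdeg with h | h
    · exact absurd h hFi
    · push_cast
      have : (F₁.natDegree : ℝ) < F₀.natDegree := by exact_mod_cast h
      linarith
  have hirr' : ∃ i, Irrational (r i) := by
    rcases hirr with h | h
    · exact ⟨0, h⟩
    · exact ⟨1, h⟩
  exact unprojectedDense_polyFibredGraph_hyperplane_mixed_all r hr₀ c hirr' A F hF₀ hAh hd0 hν' hfast

/-- **A rational-`ν` member of `EC(3,2)` in the mixed regime is dense.**
`W = {x₂ = √2x₀ + x₁/2, y₀ = x₀ + y₂², y₁ = x₁ + y₂}` (`e^z = z + e^{2(√2z + w/2)}`,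
`e^w = w + e^{√2z + w/2}`; `ν = 0`): all seven hypotheses of `ECCell 3 2`, not linearly split,
`W ∩ Γ_exp ≠ ∅` AND `I(W ∩ Γ_exp) = I(W)`. (new)
[cite: MantovaMasser2023, §1 p.5 (the open case dim π(V) = 2 in ℂ³×ℂˣ³)] -/
theorem sqrtTwoHalfMixed_member_dense :
    (IsIrreducibleClosed ℂ (polyFibredGraph (hyperplanePoly ![Real.sqrt 2, 1 / 2] 0)
        (fun j => X j) ![X 0, 1]) ∧
      (polyFibredGraph (hyperplanePoly ![Real.sqrt 2, 1 / 2] 0) (fun j => X j) ![X 0, 1] ∩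
        torusLocus ℂ 3).Nonempty ∧
      IsRotund ℂ 3 (polyFibredGraph (hyperplanePoly ![Real.sqrt 2, 1 / 2] 0) (fun j => X j) ![X 0, 1] ∩
        torusLocus ℂ 3) ∧
      IsAddFree ℂ 3 (polyFibredGraph (hyperplanePoly ![Real.sqrt 2, 1 / 2] 0) (fun j => X j) ![X 0, 1] ∩
        torusLocus ℂ 3) ∧
      IsMulFree ℂ 3 (polyFibredGraph (hyperplanePoly ![Real.sqrt 2, 1 / 2] 0) (fun j => X j) ![X 0, 1] ∩
        torusLocus ℂ 3) ∧
      zariskiDim ℂ (polyFibredGraph (hyperplanePoly ![Real.sqrt 2, 1 / 2] 0) (fun j => X j) ![X 0, 1]) =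
        (3 : ℕ) ∧
      addProjDim ℂ 3 (polyFibredGraph (hyperplanePoly ![Real.sqrt 2, 1 / 2] 0) (fun j => X j) ![X 0, 1]) =
        (2 : ℕ)) ∧
    ¬ IsLinearSplit ℂ 3 (polyFibredGraph (hyperplanePoly ![Real.sqrt 2, 1 / 2] 0) (fun j => X j)
      ![X 0, 1]) ∧
    (polyFibredGraph (hyperplanePoly ![Real.sqrt 2, 1 / 2] 0) (fun j => X j) ![X 0, 1] ∩
      expGraph ℂ 3).Nonempty ∧
    UnprojectedDense (polyFibredGraph (hyperplanePoly ![Real.sqrt 2, 1 / 2] 0) (fun j => X j)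
      ![X 0, 1]) := by
  have h2 : 0 < Real.sqrt 2 := Real.sqrt_pos.2 (by norm_num)
  have hF : (![X 0, 1] : Fin 2 → MvPolynomial (Fin 3) ℂ) =
      fun j => ((![Polynomial.X, Polynomial.C 1] : Fin 2 → Polynomial ℂ) j).toMvPolynomial 0 := by
    funext j
    fin_cases j <;> simp
  have hAinj : Function.Injective (aeval (fun j : Fin 2 => (X j : MvPolynomial (Fin 2) ℂ)) :
      MvPolynomial (Fin 2) ℂ →ₐ[ℂ] MvPolynomial (Fin 2) ℂ) := by
    rw [aeval_X_left]; exact fun _ _ h => h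
  have hirr : ∃ i : Fin 2, Irrational ((![Real.sqrt 2, 1 / 2] : Fin 2 → ℝ) i) :=
    ⟨0, by simpa using irrational_sqrt_two⟩
  have hν : ((1 : ℝ) / ((Polynomial.X : Polynomial ℂ).natDegree + 1) - 1 / 2) / Real.sqrt 2 < 1 := by
    rw [Polynomial.natDegree_X]; norm_num
  have hdense := unprojectedDense_mixed_diag_all h2.ne' (by norm_num : (1 / 2 : ℝ) ≠ 0)
    (Or.inl irrational_sqrt_two) 0 Polynomial.X_ne_zero (Polynomial.C 1)
    (Or.inr (by rw [Polynomial.natDegree_C, Polynomial.natDegree_X]; exact one_pos)) hν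
  rw [hF]
  have hcell := ecCell_hypotheses_polyFibredGraph_hyperplane ![Real.sqrt 2, 1 / 2] 0 (fun j => X j)
    (fun j => ((![Polynomial.X, Polynomial.C 1] : Fin 2 → Polynomial ℂ) j).toMvPolynomial 0) hAinj hirr
  refine ⟨hcell, not_isLinearSplit_polyFibredGraph _ _ _ (Nat.succ_pos 1) hAinj, ?_, hdense⟩
  obtain ⟨w, hw, -⟩ := hcell.2.1
  exact inter_expGraph_nonempty_of_vanishingIdeal_eq ⟨w, hw⟩ hdense

end Diag

end Summit.Schanuel.Schanuel.Theorems

end
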